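import Summits.QuantumFields.YangMills.Theorems.BalabanUVNodesN13Cor3AsymJunctionThm2KeyedFullBudgetAtRecord13CoPH
import Summits.QuantumFields.YangMills.Theorems.BalabanUVNodesN11Thm2SupplyDefs

/-!
# BalabanUVNodes ∕ N13 — THE N11 → N13 EDGE END AT NODE 00's STAGE-13 RECORD WITH THE PRINTED BUDGET FROM [III] §3's TWO SUPPLY TOKENS: part 1's chain edition with
# `B14.Thm2Printed` keyed REPLACED by dag-n11-w2's named §3 sentences `Thm2ESupplyAt ∕ Thm2RSupplyAt` at the chain witness — explicit constants, no existential
# (Track A, DAG node N13 = [B16]; cluster K1 — K1⁷ `StabilityBAtRecordR13SepCoPH` = stmt-QuantumFields-20542, helper `--as helper`; seat `pub-ymgap-dag-n13-w2` g3, own-lineage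
# successor of part 1 `…N13Cor3AsymJunctionThm2KeyedFullBudgetAtRecord13CoPH`; consumer of dag-n11-w2's `…N11Thm2SupplyDefs`; 2026-08-28; count-neutral)

[B16] = T. Bałaban, *Large field renormalization. II. Localization, exponentiation, and bounds for the 𝐑 operation*, Commun. Math. Phys. **122** (1989) 355–392
[Balaban1989LargeFieldII] ((0.1), (1.72), (1.80), p. 387, p. 391); [III] = [Balaban1988Convergent] Thm 1 p. 262, Thm 2 p. 263, (2.41)–(2.50) pp. 261–264, §3 p. 279, (3.65)–(3.67) p. 283.

statement-level bookkeeping of a published proof with citation tags; proofs kernel-checked; nothing here is a claim about the Yang–Mills mass gap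

CITATION HEADER (v1.0.1: quotations made verbatim from the text layer).  [III] p. 283, after (3.67): *"for z ∈ Λ_j^{(n)} ∩ (Ω_n∖Ω_{n+1}), β > 0. Summing over z ∈ Λ_j^{(n)} ∩ Ω we
get the inequality (2.43) in Theorem 2 (with 1 − β, β > 0, instead of β < 1). Thus we have proved the first part of Theorem 2, concerning the functions E^{(j)}. The inequality (2.44)
for the functions R^{(j)} can be proved in an almost identical way."*; p. 264: *"These bounds yield the following bounds for the effective actions"* (2.49) and *"Corollary 3
(Ultraviolet Stability). Under the assumptions of Theorem 1 there exist constants E₋, E₊ independent of η and T, but depending on g_k, such that"* (2.50).  [B16] p. 387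
ll. 21–27: *"… hence also an improved bound (1.89), with the additional term −κ₁d_k(X) in the exponential. This implies the inequality (2.50) [III], hence Corollary 3."*

WHY THIS FILE.  Part 1 §2 (`uvIneq_at_record₁₃CoPH_of_thm2Printed_chainWitness_of_obligations_of_fullBudget`) reads [III] Theorem 2 KEYED to dag-n11-e's chain as ONE token
`B14.Thm2Printed …` and therefore concludes with `∃ E₁ R₁`.  dag-n11-w2's definition-lane file `…N11Thm2SupplyDefs` names the two §3 SENTENCES print sums into (2.43) ∕ (2.44) —
`Thm2ESupplyAt` ((3.65) + (3.67) per point) and `Thm2RSupplyAt` (p. 283 per domain) — and PRODUCES the keyed tokens from them with explicit constants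
(`ineq243_keyed_of_eSupply` ∕ `ineq244_keyed_of_rSupply`: `L := F.L`, `β := 1 − b`, `E₁ := cE`, `R₁ := cR·K₀(4·2^d,2d)`).  THIS FILE plugs those into part 1 §1: the END at the
record along the chain with NO existential — (2.46)'s smallness reads `cR·K₀(4·2^d,2d)·g_n^{κ₀−6} ≤ 1` and `C_A = cE(1−L^{−(1−b)})⁻¹ + 1 + 2·θ.s2.lf.B₀·K₀(4·2^d,2d) + E₂`.

WHAT THIS FILE PROVES (1 theorem, 0 `def`, 0 `sorry`; BY NAME over part 1 §0∕§1, dag-n11-w2's `…SupplyDefs` ∕ `…AlongSupplyChain`, dag-n11-e's `chainFormAt_all_of_obligations`).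
★★★ `uvIneq_at_record₁₃CoPH_of_thm2Supply_chainWitness_of_obligations_of_fullBudget`.

HONEST SCOPE ∕ A6.  By-name junction, count-neutral, LOCATED exactly as part 1: `hH` (the (1.72) representation of `densOfRecord₁₃`) has NO supplier (n10-w1 GAP #1); the
seams `hA'eq` ∕ `hφ1` ∕ `hU` are what `R` and the carrier ARE; the §3 supply tokens (dag-n11-w2: «the inhabitant at a non-empty class is [III] §3's analysis, LOCATED, nobody's
theorem»), the chain's obligations `(hσ, hT)`, (1.79)∕(1.80)∕(1.80)⁺, the (1.90) gas stay HYPOTHESES; nothing of Bałaban's asserted; N11 ∕ N13 NOT discharged; K0⁷ ∕ K1⁷ NOT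
closed (`stub_nodes13PWS` ∕ `stub_runRows13PWS` NOT proved); counts UNMOVED (discharged 5∕27 · Track A 5∕28); one finite `𝕋⁴_{L^K}` programme at fixed `ε = L^{−K}`, Bałaban
AS PRINTED; R4 closes the conditional finite-𝕋⁴ rung `BalabanLadder.UV` only — the Yang–Mills mass gap (Clay) is NOT proved by any of this; nothing continuum ∕ ℝ⁴ ∕ OS.
No `def`, no `sorry`, no `instance`, no `notation`.
-/

noncomputable section

open MeasureTheory
open scoped BigOperators Matrix.Norms.L2Operator

namespace Summit.QuantumFields.YangMills.BalabanUVNodes.N13Cor3AsymJunctionThm2SupplyFullBudgetAtRecord13CoPH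

open Literature.MathematicalPhysics.QuantumFieldTheory.Balaban1983to89 Step B14.Eq225Concrete B14.LocalCoupling B14Thm2 Finset
open T4Continuum T4DatumAssembly Node00 DagBinding FlowStepRuns B15DeterminingSets
open B10Eq38TorusDomains (toFine)
open B16Cor3Ops (PosOp Repr172)
open TreeLengthTorus (tsys proj TPt TAdj)
open B13FamilySum (Ineq126 VolBound)
open B16Eq190Resummation (bracket mayerTerm F191 polys190 LocalOps DepOn)
open B13ScaleTransfer (Pt FaceConnected)
open TreeLength (treeLen)
open B16SProfile (Sop)
open B13Factor210Literal (fineCubes)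
open Summit.QuantumFields.YangMills.Theorems.BalabanUVNodesN11Sect3SupplyChainDefs (Sect3Supplier chainWitness)
open Summit.QuantumFields.YangMills.Theorems.BalabanUVNodesN11Sect3SupplyChainObligationsDefs (SupplierObligations NoExpansionObligation ChainFormAt
  chainFormAt_all_of_obligations)
open Summit.QuantumFields.YangMills.Theorems.BalabanUVNodesN11Thm2Sect2DataOfRecordKeyedDefs (sect2DataOfRecord₁₃Keyed)
open Summit.QuantumFields.YangMills.Theorems.BalabanUVNodesN11Thm2AlongSupplyChain (h248_chainWitness_of_chainFormAt)

open Summit.QuantumFields.YangMills.Theorems.BalabanUVNodesN11Thm2SupplyDefs (Thm2ESupplyAt Thm2RSupplyAt ineq243_keyed_of_eSupply ineq244_keyed_of_rSupply)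
open Summit.QuantumFields.YangMills.BalabanUVNodes.N13Cor3AsymJunctionThm2KeyedFullBudgetAtRecord13CoPH (cA_nonneg uvIneq_at_record₁₃CoPH_of_ineq243_ineq244_keyed_of_fullBudget)

/-! ## §1. THE SUPPLY EDITION: the two keyed tokens PRODUCED from dag-n11-w2's [III] §3 supply tokens `Thm2ESupplyAt ∕ Thm2RSupplyAt` at the chain witness — explicit constants -/

section SupplyEnd

variable (F : T4Family) (N : ℕ) [NeZero N]
variable (θ : Stage13HParams F N) (h : θ.Provisos₁₃CoPH F N) (P : B12.RunParams) (k : ℕ)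
variable (𝒰 : (k : ℕ) → SeqOfRecord F θ.ν θ.τ9.M (gOfRecord₁₃ F N θ.toStage13Params P) P.K k → Set (GaugeField (F.P P.K) 0 (SU N)))

open Classical in
/-- **★★★ (UV₁₃) AT LEVEL `k ≤ K` OF THE RUN `P` AT NODE 00's STAGE-13 RECORD ALONG dag-n11-e's SUPPLY CHAIN FROM [III] §3's TWO SUPPLY TOKENS + THE PRINTED BUDGET,
(2.48) DISCHARGED, EXPLICIT CONSTANTS** — part 1 §2 with `B14.Thm2Printed` keyed REPLACED by dag-n11-w2's two named §3 sentences at the chain witness on the class `𝒰`: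
`Thm2ESupplyAt θ P (chain witness) 𝒰 b cE` ((3.65) + (3.67) per point, exponent `5 − b`) and `Thm2RSupplyAt θ P (chain witness) 𝒰 κR cR κ₀` (p. 283 per domain) — the two
keyed tokens of part 1 §1 PRODUCED by `ineq243_keyed_of_eSupply` ∕ `ineq244_keyed_of_rSupply` with `L := F.L`, `β := 1 − b`, `E₁ := cE`, `R₁ := cR·K₀(4·2^d,2d)`; hence NO
existential: (2.46)'s smallness reads `cR·K₀(4·2^d,2d)·g_n^{κ₀−6} ≤ 1` and the conclusion is (0.1) at every `V` with `C_A = cE(1−L^{−(1−b)})⁻¹ + 1 + 2B₁ + E₂`,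
`B₁ = θ.s2.lf.B₀·K₀(4·2^d,2d)`.  Rows as part 1 §2 (`0 < b < 1`, `1 < L` in place of `0 < β < 1`, `H033`).  CONDITIONAL on every input — LOCATED as part 1; the §3 supply tokens, the
obligations, (1.79)∕(1.80)∕(1.80)⁺, the (1.90) gas, `hH` are HYPOTHESES ([III] §3's analysis NOT proved); nothing of Bałaban's asserted; N11 ∕ N13 NOT discharged; count-neutral.
[cite: Balaban1988Convergent, (3.65)–(3.67) p.283, p.283, Thm 2 (2.43)–(2.44) p.263, (2.45)–(2.50) pp.263–264; Balaban1989LargeFieldII, (0.1) p.356, (1.72) p.379, p.387 ll.21–27, p.391] -/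
theorem uvIneq_at_record₁₃CoPH_of_thm2Supply_chainWitness_of_obligations_of_fullBudget (Nc : ℕ) [NeZero Nc] (R : Repr172 (GaugeField (F.P P.K) k (SU N)) (tsys 4 Nc).Dom)
    {M₁ : ℝ} (hM : M₁ ≠ 0) (hnum : (Fintype.card (Site (F.P P.K) k) : ℝ) = (M₁ * Nc) ^ 4)
    {κ₁ : ℝ} (hκ : B12TreeDecay.kappa₀ (4 * 2 ^ 4) (2 * 4) ≤ κ₁) (hκ₁ : 0 ≤ κ₁) (c₀ : ℝ)
    (hH : R.Holds (densOfRecord₁₃ F N θ.toStage13Params P k))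
    (hχ01 : ∀ a V, 0 ≤ R.χ a V ∧ R.χ a V ≤ 1)
    (h0χ : ∀ V, R.χ R.allSmall V = chiβOfRecord₁₃ F N θ.toStage13Params P.K (gOfRecord₁₃ F N θ.toStage13Params P) k V)
    -- the components of `Z_k`: composite structure and per-component (1.79)/(1.80) data
    (T : R.Adm → (tsys 4 Nc).Dom → PosOp (GaugeField (F.P P.K) k (SU N))) (l : R.Adm → List (tsys 4 Nc).Dom)
    (hnd : ∀ a, (l a).Nodup) (hset : ∀ a, (l a).toFinset = R.Zc a)
    (hTZ : ∀ a Fn V, (R.TZ a).T Fn V = (PosOp.pi (T a) (l a)).T Fn V)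
    (b : Step.Budget.Consts) (Lb : ℝ) {Rk q : ℕ} (hRk : 0 < Rk) (hq : 0 < q)
    (hC : 0 ≤ b.C) (hbM : 0 ≤ b.M) (hRm : ∀ m, 0 ≤ b.R m) (hdim : b.d = 4) (hRq : ((Rk * q : ℕ) : ℝ) = Lb * b.R (k + 1)) (hLb : 0 ≤ Lb)
    (hslope2 : 2 * (κ₁ * (4 * 2 ^ 4) * Lb ^ b.d) ≤ b.C * b.M ^ b.d * b.R (k + 1))
    (X₀ : R.Adm → (tsys 4 Nc).Dom → Finset (Pt 4)) (K : R.Adm → (tsys 4 Nc).Dom → ℕ)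
    (κ Pp : R.Adm → (tsys 4 Nc).Dom → ℝ) (s : R.Adm → (tsys 4 Nc).Dom → ℕ → ℝ)
    (hdataZ : ∀ a, ∀ X ∈ R.Zc a, (X₀ a X).Nonempty ∧ FaceConnected (X₀ a X) ∧
      X.1 = (fineCubes Rk (X₀ a X)).image (proj Nc) ∧ 1 ≤ K a X ∧
      (∀ V, (T a X).T 1 V ≤ Real.exp (-(κ a X) - Pp a X)) ∧ Step.Budget.Controls b k (K a X) (κ a X) (s a X) ∧
      (∀ m, 0 ≤ s a X m) ∧ s a X (k + 1) = treeLen (Sop q (X₀ a X)) ∧ c₀ ≤ Pp a X)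
    -- the domains `Y_i`: composite structure and per-domain (1.80)⁺ horizon-0 data
    (TY : R.Adm → (tsys 4 Nc).Dom → PosOp (GaugeField (F.P P.K) k (SU N))) (lY : R.Adm → List (tsys 4 Nc).Dom)
    (hndY : ∀ a, (lY a).Nodup) (hsetY : ∀ a, (lY a).toFinset = R.Ys a)
    (hTYs : ∀ a Fn V, (R.TYs a).T Fn V = (PosOp.pi (TY a) (lY a)).T Fn V)
    (SY : R.Adm → (tsys 4 Nc).Dom → Finset (Pt 4)) (κY PY : R.Adm → (tsys 4 Nc).Dom → ℝ) (sY : R.Adm → (tsys 4 Nc).Dom → ℕ → ℝ)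
    (hdataY : ∀ a, ∀ Y ∈ R.Ys a, (SY a Y).Nonempty ∧ FaceConnected (SY a Y) ∧
      Y.1 = (fineCubes Rk (SY a Y)).image (proj Nc) ∧ (∀ V, (TY a Y).T 1 V ≤ Real.exp (-(κY a Y) - PY a Y)) ∧
      Step.Budget.Controls b k 0 (κY a Y - κ₁ * treeLen (fineCubes Rk (SY a Y))) (sY a Y) ∧ c₀ ≤ PY a Y)
    -- the (1.90) gas of every admissible term (verbatim)
    {LF DomY Cube Var Sv : Type*} [Fintype LF] [Fintype DomY] [Fintype Cube] [DecidableEq LF] [DecidableEq DomY]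
    [DecidableEq Cube] {adjC : Cube → Cube → Prop} [DecidableRel adjC]
    (hrefl : ∀ a, adjC a a) (hsymm : ∀ a b, adjC a b → adjC b a)
    {locX : LF → Finset Cube} {locY : DomY → Finset Cube} {site : Var → Cube} (Yfix : R.Adm → Finset Cube)
    (houtX : ∀ a j, (locX j \ Yfix a).Nonempty) (houtY : ∀ a Y, (locY Y \ Yfix a).Nonempty)
    (Op : R.Adm → Finset LF → ((Var → Sv) → ℂ) →+ ((Var → Sv) → ℂ))
    (hOps : ∀ a, LocalOps adjC locX (Yfix a) site (Op a))
    (hOpReal : ∀ a (S : Finset LF) (f : (Var → Sv) → ℂ), (∀ ψ, (f ψ).im = 0) → ∀ φ, (Op a S f φ).im = 0)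
    (Vt : R.Adm → DomY → (Var → Sv) → ℂ) (hV : ∀ a Y, DepOn (Yfix a) site (Vt a Y) (locY Y))
    (hVreal : ∀ a Y ψ, (Vt a Y ψ).im = 0) (cfg : GaugeField (F.P P.K) k (SU N) → (Var → Sv))
    {nbr : Cube → Finset Cube} (hnbr : ∀ a b, adjC a b → a ∈ nbr b) {νn : ℝ} (hν : ∀ b, ((nbr b).card : ℝ) ≤ νn)
    {d : R.Adm → Finset Cube → ℝ} {c₁ Rr κc K₀ cv τ : ℝ} (hd : ∀ a X, 0 ≤ d a X) (hc₁ : 0 ≤ c₁) (hK₀ : 0 ≤ K₀) (hτ : 0 ≤ τ)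
    (h197 : ∀ a V X, ‖F191 adjC locX locY (Yfix a) (mayerTerm (Op a) (Vt a) (cfg V)) X‖ ≤ c₁ * Real.exp (-(Rr * d a X)))
    (h126 : ∀ a, Ineq126 (polys190 adjC locX locY (Yfix a)) (fun X => X \ Yfix a) (d a) κc K₀)
    (hvol : ∀ a, VolBound (polys190 adjC locX locY (Yfix a)) (fun X => X \ Yfix a) (d a) cv)
    (hrate : κc + τ * cv ≤ Rr) (hsmall : c₁ * Real.exp (τ * cv) * K₀ * νn ≤ τ)
    (hjunction : ∀ a V, R.curly a V = (bracket (Op a) (Vt a) (cfg V)).re)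
    {πc : ℝ} (hQ : (Fintype.card Cube : ℝ) ≤ πc * (Fintype.card (Site (F.P P.K) k) : ℝ))
    -- dag-n11-e's supply chain on the live-selector line and [III] §3's two SUPPLY TOKENS at the chain witness on the class `𝒰`
    (σ : Sect3Supplier θ P)
    (hsel : θ.ppSel = ppSelLiveOfRecord F N θ.ν θ.τ9 (EOfRecord₁₃ F N θ.toStage13Params) (wOfRecord₉ F N θ.toStage9Params))
    (hθ : θ.Admissible F N) (hE₀ : 0 ≤ θ.s2.lf.E₀) (hB₀ : 0 ≤ θ.s2.lf.B₀) (hMτ : 1 ≤ θ.τ9.M)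
    (hκd : B12TreeDecay.kappa₀ (4 * 2 ^ (F.P P.K).d) (2 * (F.P P.K).d) ≤ θ.s2.lf.κ)
    (hσ : SupplierObligations θ P σ) (hT : NoExpansionObligation θ P σ)
    {bE cE κR cR : ℝ} {κ₀ : ℕ}
    (hES : Thm2ESupplyAt θ P (fun k s => (chainWitness θ P σ k).1 s) 𝒰 bE cE)
    (hRS : Thm2RSupplyAt θ P (fun k s => (chainWitness θ P σ k).1 s) 𝒰 κR cR κ₀)
    (hb1 : bE < 1) (hL : 1 < ((F.P P.K).L : ℝ)) (hκ7 : 7 ≤ κ₀)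
    (hg : ∀ j, j ≤ P.K → 0 ≤ gOfRecord₁₃ F N θ.toStage13Params P j)
    (h𝒰 : ∀ k (s : SeqOfRecord F θ.ν θ.τ9.M (gOfRecord₁₃ F N θ.toStage13Params P) P.K k) (U : GaugeField (F.P P.K) 0 (SU N)), U ∈ 𝒰 k s →
      ∀ j, 1 ≤ j → j ≤ k → ∀ X, Sect2.admB (F.P P.K) θ.ν θ.τ9.M (gOfRecord₁₃ F N θ.toStage13Params P) s.Ω s.Λ j (Sect2.domSites (F.P P.K) θ.τ9.M j X) = true →
        Sect2.ofBackgroundC (ιSU N) U ∈ Sect2.spaceMS (settingOfRecord₁₃ F N θ.toStage13Params P) (θ.rzAt P s) θ.τ9.M j (Sect2.domSites (F.P P.K) θ.τ9.M j X) s.Ω)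
    (hk : k ≤ P.K)
    -- the configuration-indexed data READ THROUGH THE CARRIER: history, membership of `U_k(V)`, fluctuation argument, volumes (region and ring)
    (sV : (V : GaugeField (F.P P.K) k (SU N)) → SeqOfRecord F θ.ν θ.τ9.M (gOfRecord₁₃ F N θ.toStage13Params P) P.K k)
    (hU : ∀ V, Uk F N P.K k θ.εbg V ∈ 𝒰 k (sV V))
    (aV : GaugeField (F.P P.K) k (SU N) → Tk.SFluct (F.P P.K) (FluctV N))
    (Ek EkLog EkRest : ℝ) (hEk : Ek = EkLog + EkRest) (E₂ : ℝ) (Γ : ℕ → ℝ)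
    (hΓvol : ∀ V, ∀ n, 1 ≤ n → n ≤ k → ((univ.filter fun y : Site (F.P P.K) n => toFine n y ∈ gammaRegion (sV V).Ω k n).card : ℝ) ≤ Γ n)
    (hΓr : ∀ V, ∀ n, 1 ≤ n → n ≤ k →
      ((univ.filter fun c : TPt (F.P P.K).d (Sect2.domCount (F.P P.K) θ.τ9.M n) =>
          (Sect2.domSites (F.P P.K) θ.τ9.M n (Sect2.cubeDom (F.P P.K) θ.τ9.M n c) ∩
              Sect2.enlT (F.P P.K) (Sect2.zSide (F.P P.K) θ.ν θ.τ9.M (gOfRecord₁₃ F N θ.toStage13Params P) n) 1 ((sV V).Λ n)ᶜ).Nonempty ∧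
            ∃ c', (c' = c ∨ TAdj c' c) ∧ (Sect2.domSites (F.P P.K) θ.τ9.M n (Sect2.cubeDom (F.P P.K) θ.τ9.M n c') ∩ (sV V).Ω n).Nonempty).card : ℝ) ≤ Γ n)
    (hβj : ∀ j, 1 ≤ j → j ≤ k → 0 ≤ 1 / gOfRecord₁₃ F N θ.toStage13Params P (j - 1) ^ 2 - 1 / gOfRecord₁₃ F N θ.toStage13Params P j ^ 2)
    (hφ : ∀ V, ∀ j, 1 ≤ j → j ≤ k → ∀ x, θ.Phih P k (sV V).Ω (sV V).Λ j x ≤ 1)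
    (hφ1 : ∀ V, chiβOfRecord₁₃ F N θ.toStage13Params P.K (gOfRecord₁₃ F N θ.toStage13Params P) k V ≠ 0 →
      ∀ j, 1 ≤ j → j ≤ k → ∀ x, θ.Phih P k (sV V).Ω (sV V).Λ j x = 1)
    (hsum : ∀ n, 1 ≤ n → n ≤ k → ∑ j ∈ Icc 1 n, (gOfRecord₁₃ F N θ.toStage13Params P j) ^ κ₀ ≤ (gOfRecord₁₃ F N θ.toStage13Params P n) ^ (κ₀ - 6))
    (hsmall6 : ∀ n, 1 ≤ n → n ≤ k →
      cR * B12TreeDecay.K₀ (4 * 2 ^ (F.P P.K).d) (2 * (F.P P.K).d) * (gOfRecord₁₃ F N θ.toStage13Params P n) ^ (κ₀ - 6) ≤ 1)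
    (hvac : VacuumRestBound EkRest E₂ Γ k)
    (hA'eq : ∀ V, R.A' V =
      (sect2ActionDataOfRecord F N (FluctV N) P.K (settingOfRecord₁₃ F N θ.toStage13Params P) (θ.rzAt P (sV V)) (sV V)
        ((chainWitness θ P σ k).1 (sV V)) (aV V) Ek).action23 k (Uk F N P.K k θ.εbg V))
    -- the sizes of the logarithmic vacuum term, the volume majorant, the sign of the `E₁`-free part of Theorem 2's constant
    {cΓ cL cL' : ℝ} (hrest : 0 ≤ 1 + 2 * (θ.s2.lf.B₀ * B12TreeDecay.K₀ (4 * 2 ^ (F.P P.K).d) (2 * (F.P P.K).d)) + E₂)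
    (hΓ : ∑ n ∈ Icc 1 k, Γ n ≤ cΓ * (Fintype.card (Site (F.P P.K) k) : ℝ))
    (hlog : -(cL * (Fintype.card (Site (F.P P.K) k) : ℝ)) ≤ -EkLog)
    (hlog' : -EkLog ≤ cL' * (Fintype.card (Site (F.P P.K) k) : ℝ)) :
    ∀ V : GaugeField (F.P P.K) k (SU N),
      B16.UVIneq ((datumOfRecord₁₃CoPH F N θ h).C P) k V
        ((cE * (1 - ((F.P P.K).L : ℝ) ^ (-(1 - bE)))⁻¹ + 1 + 2 * (θ.s2.lf.B₀ * B12TreeDecay.K₀ (4 * 2 ^ (F.P P.K).d) (2 * (F.P P.K).d)) + E₂) * cΓ + cL +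
          πc * (c₁ * Real.exp (τ * cv) * K₀))
        ((cE * (1 - ((F.P P.K).L : ℝ) ^ (-(1 - bE)))⁻¹ + 1 + 2 * (θ.s2.lf.B₀ * B12TreeDecay.K₀ (4 * 2 ^ (F.P P.K).d) (2 * (F.P P.K).d)) + E₂) * cΓ + cL' +
          πc * (c₁ * Real.exp (τ * cv) * K₀) + M₁⁻¹ ^ 4 * B12TreeDecay.K₀ (4 * 2 ^ 4) (2 * 4) * ∑ _i : Fin 2, Real.exp (-c₀)) := by
  have hκ0 : 0 ≤ θ.s2.lf.κ := (B12TreeDecay.kappa₀_nonneg (by positivity) _).trans hκd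
  have h243K := ineq243_keyed_of_eSupply θ P (fun k s => (chainWitness θ P σ k).1 s) 𝒰 hES
  have h244K := ineq244_keyed_of_rSupply θ P (fun k s => (chainWitness θ P σ k).1 s) 𝒰 hMτ hg hRS
  have hβ0 : 0 < 1 - bE := by linarith
  have hR : 0 ≤ cR * B12TreeDecay.K₀ (4 * 2 ^ (F.P P.K).d) (2 * (F.P P.K).d) := mul_nonneg hRS.nonneg (le_of_lt (B12TreeDecay.K₀_pos _ _))
  have hkmK : k ≤ (F.P P.K).m + (F.P P.K).K := by rw [T4Family.P_K]; omega
  have hform : ChainFormAt θ P σ k := chainFormAt_all_of_obligations h hsel hθ hκ0 hE₀ hB₀ hMτ σ hσ hT k hk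
  have h248 : ∀ V : GaugeField (F.P P.K) k (SU N),
      |B240 (sect2TowerOfRecord F N (FluctV N) P.K (settingOfRecord₁₃ F N θ.toStage13Params P) (θ.rzAt P (sV V)) (sV V) ((chainWitness θ P σ k).1 (sV V)))
        (fun j X => Sect2.admB (F.P P.K) θ.ν θ.τ9.M (gOfRecord₁₃ F N θ.toStage13Params P) (sV V).Ω (sV V).Λ j (Sect2.domSites (F.P P.K) θ.τ9.M j X)) (aV V) k
        (Uk F N P.K k θ.εbg V)| ≤ 2 * (θ.s2.lf.B₀ * B12TreeDecay.K₀ (4 * 2 ^ (F.P P.K).d) (2 * (F.P P.K).d)) * ∑ n ∈ Icc 1 k, Γ n := fun V =>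
    h248_chainWitness_of_chainFormAt θ P σ hform (sV V) (aV V) (Uk F N P.K k θ.εbg V) hkmK hMτ hκd hB₀ (h𝒰 k (sV V) (Uk F N P.K k θ.εbg V) (hU V)) Γ (hΓr V)
  have hCA : 0 ≤ cE * (1 - ((F.P P.K).L : ℝ) ^ (-(1 - bE)))⁻¹ + 1 + 2 * (θ.s2.lf.B₀ * B12TreeDecay.K₀ (4 * 2 ^ (F.P P.K).d) (2 * (F.P P.K).d)) + E₂ :=
    cA_nonneg hES.nonneg hL hβ0 hrest
  exact uvIneq_at_record₁₃CoPH_of_ineq243_ineq244_keyed_of_fullBudget F N θ h P k (fun k s => (chainWitness θ P σ k).1 s) 𝒰 Nc R hM hnum hκ hκ₁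
    c₀ hH hχ01 h0χ T l hnd hset hTZ b Lb hRk hq hC hbM hRm hdim hRq hLb hslope2 X₀ K κ Pp s hdataZ TY lY hndY hsetY hTYs SY κY PY sY hdataY
    hrefl hsymm Yfix houtX houtY Op hOps hOpReal Vt hV hVreal cfg hnbr hν hd hc₁ hK₀ hτ h197 h126 hvol hrate hsmall hjunction hQ h243K h244K hL
    hβ0 hES.nonneg hR hκ7 hk hg sV hU aV Ek EkLog EkRest hEk (θ.s2.lf.B₀ * B12TreeDecay.K₀ (4 * 2 ^ (F.P P.K).d) (2 * (F.P P.K).d)) E₂ Γ hΓvol hβj hφ hφ1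
    hsum hsmall6 h248 hvac hA'eq hCA hΓ hlog hlog'

end SupplyEnd

end Summit.QuantumFields.YangMills.BalabanUVNodes.N13Cor3AsymJunctionThm2SupplyFullBudgetAtRecord13CoPH

end
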